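import Summits.HodgeConjecture.HodgeConjecture.Theses.QbarEnvelope

/-!
# Route QbarEnvelope — `TargetOfCruxes` (glue item stmt-HodgeConjecture-14229)

`Envelope → HCOverNumberFields → Target`: the route's `Target` is literally the conjunction of the two
cruxes `Envelope` and `HCOverNumberFields` (same bodies).  Pure logic; no other import, no named-fact
hypothesis, no sorry.
-/

-- `Summit.HodgeConjecture.HodgeConjecture.Theorems` is the mandated namespace (single-problem
-- summit: Problem = Summit), which `linter.dupNamespace` flags on every declaration; the lakefile
-- turns the linter off tree-wide (weak option), restated here so stand-alone elaboration is
-- warning-free too.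
set_option linter.dupNamespace false

namespace Summit.HodgeConjecture.HodgeConjecture.Theorems

/-- **Item stmt-HodgeConjecture-14229 (`TargetOfCruxes`), route `QbarEnvelope`**:
`Target = Envelope ∧ HCOverNumberFields`, so the pair of cruxes is the target. [cite: Deligne2000, §1] -/
theorem qbarEnvelope_targetOfCruxes_proof :
    Summit.HodgeConjecture.HodgeConjecture.Theses.QbarEnvelope.TargetOfCruxes :=
  fun hE hC ↦ ⟨hE, hC⟩

end Summit.HodgeConjecture.HodgeConjecture.Theorems
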